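import Summits.RiemannHypothesis.RiemannHypothesis.Theorems.TiltedLandingLaw421R3Lens1Pinning
import Summits.RiemannHypothesis.RiemannHypothesis.Theorems.TiltedLandingLaw421R3FarStep5
import Summits.RiemannHypothesis.RiemannHypothesis.Theorems.TiltedLandingLaw421R3ColumnImmunity
import Summits.RiemannHypothesis.RiemannHypothesis.Theorems.TiltedLandingLaw421R3ClusterStep

/-!
# TiltedLandingLaw421R3 — lens-1 (O3-a, director-rh g23): FIRST RUNGS of the law-elect `TopPinning` — PROVED

LENS-1 gen-5 module image `rh33346-cover/lens-1/PinningIso-v1.lean` (landing target `…/Theorems/TiltedLandingLaw421R3Lens1PinningIso.lean`;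
imports the LANDED `…R3Lens1Pinning` (`RhW08.Lens1Pinning.TopPinning`, (3o)), `…R3FarStep5` (`RhW08.IsolatedTilt.tilt_of_isolated_circle`),
`…R3ColumnImmunity` (`RhW08.Column.abs_im_le_of_level`, `jensenClear_top`, `jensenClear_vline`, `realEntireLt2_of_hyps`) and `…R3ClusterStep`
(`RhW08.QuadW.jensen_host_levelj`, `nlEventOf_of_not_localB`) — checked BY IMPORT, nothing inlined; namespace `RhW08.Lens1PinningIso`;
0 `sorry`, no instances/notation, FQN-cites only).

CONTENT — two PROVED special cases of the OPEN law `RhW08.Lens1Pinning.TopPinning` (its conclusion, verbatim, under extra hypotheses), i.e. the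
BC5-style witnesses that `TopPinning` is neither vacuous nor the crux:

§1 WALSH–JENSEN PINNING (the GEOMETRIC rung, no smallness).  `JensenIsolated f j a`: every OTHER upper zero of `f^{(j)}` has its closed Jensen
   disc DISJOINT from `a`'s closed disc or STRICTLY NESTED inside it (lower nested pairs and real zeros inside the disc are allowed; this implies
   `NoTallerToucher`).  `CleanFeet f j a`: the two feet `Re a ± Im a` of `a`'s circle are neither zeros nor critical points of `f^{(j)}`.
   ★★★ `pinning_of_jensenIsolated`: on a legal frame (`EngineHyps5 2 …`), a Jensen-isolated upper zero `a` of `f^{(j)}` with clean feet has a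
   NON-REAL zero of `f^{(j+1)}` in its closed Jensen disc (`NestedStep a w`) or an NL event `x` with `|x − Re a| < Im a`.  MECHANISM = J. L. Walsh,
   «On the location of the roots of the derivative of a polynomial», Ann. of Math. 22 (1920) §4 (isolated Jensen circle: the roots of `f′` in it are
   counted by the force signs at the feet) in the tree's WINDOW currency: the square window `[Re a − Im a, Re a + Im a] × [−(Hs+1), Hs+1]` of
   `f^{(j)}` is a Jensen `Window` (sides clear by isolation — the `a`-pair itself is clear off the axis with EQUALITY at the feet —, top clear by the
   strip `RhW08.Column.abs_im_le_of_level`), and the tree's local dichotomy `…Splittings.JensenWindow.no_nonreal_zero_of_localA_localB` (Kim 1996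
   Thm 1, window form) forbids «all critical points in the window real ∧ Laguerre sign law on the base» because `a` is a non-real zero IN the window;
   ¬(local B) is an NL event on the base (`RhW08.QuadW.nlEventOf_of_not_localB`); ¬(local A) is a non-real critical point in the window, which
   Jensen's theorem at level `j` (`RhW08.QuadW.jensen_host_levelj`) puts in the closed disc of an upper zero `c` of `f^{(j)}` — `c = a` (done), `c`
   far (impossible: the discs are disjoint and the point is in the window) or `c` nested (its disc lies inside `a`'s).
   `topPinning_case_jensenIsolated`: the literal `TopPinning` conclusion in this case.  `residual_of_not_jensenIsolated`: under `NoTallerToucher`,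
   ¬`JensenIsolated` is EXACTLY a lower-or-equal mate whose closed disc CROSSES OR TOUCHES `a`'s — the typed residual of `TopPinning` after §1
   (crit-1's L★★-killing «partial-overlap theft» population, 0.146 %), plus the finitely many dirty-feet frames.
§2 WEAK-FIELD PINNING (the head's literal O3-a: port of `RhW08.IsolatedTilt.tilt_of_isolated_circle` to the CLOSED axis disc).
   ★★ `nl_in_disc_of_weakField`: `f` real, `G := f^{(j)}` holomorphic on `ball (Re a) ρ` (`Im a < ρ`), `a` a SIMPLE zero, `a, ā` the only zeros
   of `G` in the ball, and the COFACTOR FIELD bounded on the punctured ball, `‖G′/G − 2(z − Re a)/q‖ ≤ L` with the exact smallness `Im a · L < 1`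
   ⇒ an NL event `x` with `|x − Re a| < Im a` (Rouché on the INNER circle of radius `r = Im a (1 + Im a·L)/2 < Im a`, where `(r² + Im a²)L < 2r`).
   `topPinning_case_weakField`: the literal `TopPinning` conclusion in this case.  (In the weak field the level is Ready′ anyway —
   `RhW08.IsolatedTilt.aloft_of_not_readyR2` —; the point here is the CLOSED-disc localisation `|x − Re a| < Im a`.)

HONEST LABEL: special cases PROVED ≠ the law; `TopPinning` / `RegUmbrella11S` / 33346 / 33347 stay OPEN; nothing here bears on the truth of RH;
RH is not proved.
-/

namespace RhW08.Lens1PinningIso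

open Complex Set Metric
open scoped ComplexConjugate
open Literature.Analysis.Complex
open Summit.RiemannHypothesis.RiemannHypothesis.Theorems.Splittings.JensenWindow
open RhIdea6.G17.W07C7 RhIdea6.G17.W07C7.Rev6 RhIdea6.G18.W07C8.Law421BirthS RhIdea6.G19.W07C11.Seam
open RhIdea6.G20.W07C12.Frac RhIdea6.G20.W07C12.StColP RhW07.C12.FieldSplit RhIdea6.G21.W07C13.TentMax
open RhW07.C14.TwoSided RhW07.C14.Classes RhW07.C14.Lineage RhW07.C14.Booking
open RhW07.C13.Heredity RhIdea6.G22.W07C15pre.Injection RhW07.E3.Cell RhW07.E3.Lit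
open RhW08.Round1 RhW08.StSwap RhW08.Round2 RhW08.QuadW RhW08.SealSwapQ RhW08.SealSwap RhW08.SuccB RhW08.SuccSplit
open RhW08.SuccTheft RhW08.Column RhW08.Hurwitz RhW08.ClusterQ RhW08.ClusterQM RhW08.NewtonDoor RhW08.NewtonDoorGenusOne RhW08.PurseP
open RhW08.Lens1SignCut RhW08.Lens1Coverage RhW08.IsolatedTilt RhW08.Lens1Pinning

noncomputable section

/-! ## §1 WALSH–JENSEN PINNING: a Jensen-isolated upper zero with clean feet -/

/-- `a` is JENSEN-ISOLATED at level `j`: every other upper zero `c` of `f^{(j)}` has its closed Jensen disc DISJOINT from `a`'s closed disc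
(`Im a + Im c < |Re a − Re c|`) or STRICTLY NESTED inside it (`|Re a − Re c| + Im c < Im a`).  [Walsh 1920 §4: «a circle exterior to all the
others»; nested lower pairs added — they do not change the force sign outside `a`'s circle.] -/
def JensenIsolated (f : ℂ → ℂ) (j : ℕ) (a : ℂ) : Prop :=
  ∀ c : ℂ, iteratedDeriv j f c = 0 → 0 < c.im → c ≠ a → a.im + c.im < |a.re - c.re| ∨ |a.re - c.re| + c.im < a.im

/-- CLEAN FEET: the feet `Re a − Im a`, `Re a + Im a` of `a`'s Jensen circle are neither zeros nor critical points of `f^{(j)}`. -/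
def CleanFeet (f : ℂ → ℂ) (j : ℕ) (a : ℂ) : Prop :=
  iteratedDeriv j f ((a.re - a.im : ℝ) : ℂ) ≠ 0 ∧ iteratedDeriv j f ((a.re + a.im : ℝ) : ℂ) ≠ 0 ∧
    iteratedDeriv (j + 1) f ((a.re - a.im : ℝ) : ℂ) ≠ 0 ∧ iteratedDeriv (j + 1) f ((a.re + a.im : ℝ) : ℂ) ≠ 0

/-- Jensen isolation implies the law's hypothesis `NoTallerToucher` (a strictly taller zero cannot be nested). -/
theorem noTallerToucher_of_jensenIsolated {f : ℂ → ℂ} {j : ℕ} {a : ℂ} (hapos : 0 < a.im) (hJ : JensenIsolated f j a) :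
    NoTallerToucher f j a := by
  intro b hb hab
  have hbpos : 0 < b.im := hapos.trans hab
  have hne : b ≠ a := fun h => by rw [h] at hab; exact lt_irrefl _ hab
  rcases hJ b hb hbpos hne with h | h
  · exact h
  · have := abs_nonneg (a.re - b.re); linarith

/-- A Jensen-isolated zero forces `f^{(j)} ≢ 0`. -/
theorem ne_zero_of_jensenIsolated {f : ℂ → ℂ} {j : ℕ} {a : ℂ} (hapos : 0 < a.im) (hJ : JensenIsolated f j a) :
    iteratedDeriv j f ≠ 0 := by
  intro h0
  have hc : iteratedDeriv j f (a + I) = 0 := by rw [h0]; rfl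
  have hne : a + I ≠ a := by
    intro h; have := congrArg Complex.im h; simp at this
  rcases hJ (a + I) hc (by simp; linarith) hne with h | h
  · simp at h; linarith
  · simp at h; linarith

/-- Under `NoTallerToucher`, NOT Jensen-isolated means: a lower-or-equal mate `c ≠ a` whose closed Jensen disc CROSSES OR TOUCHES `a`'s
(neither disjoint nor strictly nested) — the typed residual of `TopPinning` after §1. -/
theorem residual_of_not_jensenIsolated {f : ℂ → ℂ} {j : ℕ} {a : ℂ} (hN : NoTallerToucher f j a) (hJ : ¬ JensenIsolated f j a) :
    ∃ c : ℂ, iteratedDeriv j f c = 0 ∧ 0 < c.im ∧ c ≠ a ∧ c.im ≤ a.im ∧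
      |a.re - c.re| ≤ a.im + c.im ∧ a.im ≤ |a.re - c.re| + c.im := by
  unfold JensenIsolated at hJ
  push Not at hJ
  obtain ⟨c, hc, hcpos, hne, h1, h2⟩ := hJ
  refine ⟨c, hc, hcpos, hne, ?_, h1, h2⟩
  by_contra hlt
  push Not at hlt
  have := hN c hc hlt
  linarith

/-- Clearance of the two FEET LINES `Re = Re a ± Im a` from every non-real zero of `f^{(j)}` (non-strict; equality for the `a`-pair itself). -/
theorem feet_clear {f : ℂ → ℂ} {j : ℕ} {a : ℂ} (hGreal : ∀ z : ℂ, iteratedDeriv j f (conj z) = conj (iteratedDeriv j f z))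
    (hapos : 0 < a.im) (hJ : JensenIsolated f j a) {σ : ℝ} (hσ : σ = 1 ∨ σ = -1) :
    ∀ c : ℂ, iteratedDeriv j f c = 0 → c.im ≠ 0 → |c.im| ≤ |(a.re + σ * a.im) - c.re| := by
  intro c hc hcim
  -- an upper representative `c'` of the pair `{c, c̄}`
  obtain ⟨c', hc', hc'pos, hc're, hc'im⟩ : ∃ c' : ℂ, iteratedDeriv j f c' = 0 ∧ 0 < c'.im ∧ c'.re = c.re ∧ c'.im = |c.im| := by
    rcases lt_or_gt_of_ne hcim with hneg | hpos
    · refine ⟨conj c, by rw [hGreal, hc, map_zero], by simpa using hneg, by simp, ?_⟩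
      rw [Complex.conj_im, abs_of_neg hneg]
    · exact ⟨c, hc, hpos, rfl, (abs_of_pos hpos).symm⟩
  have hσabs : |σ * a.im| = a.im := by
    rcases hσ with h | h <;> simp [h, abs_of_pos hapos]
  by_cases hca : c' = a
  · -- the `a`-pair: equality
    have hre : c.re = a.re := by rw [← hc're, hca]
    have him : |c.im| = a.im := by rw [← hc'im, hca]
    rw [him, hre, show a.re + σ * a.im - a.re = σ * a.im by ring, hσabs]
  · rcases hJ c' hc' hc'pos hca with hfar | hnest
    · -- far: `Im a + Im c' < |Re a − Re c|`
      rw [hc're] at hfar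
      have htri : |a.re - c.re| ≤ |a.re + σ * a.im - c.re| + |σ * a.im| := by
        have := abs_sub_le (a.re - c.re) 0 (-(σ * a.im))
        have e1 : |a.re - c.re - -(σ * a.im)| = |a.re + σ * a.im - c.re| := by ring_nf
        simpa [abs_neg, e1] using abs_add_le (a.re + σ * a.im - c.re) (-(σ * a.im))
          |>.trans_eq' (by ring_nf)
      rw [hσabs] at htri
      rw [← hc'im]
      linarith
    · -- nested: `|Re a − Re c| + Im c' < Im a`
      rw [hc're] at hnest
      have htri : a.im ≤ |a.re + σ * a.im - c.re| + |a.re - c.re| := by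
        have h := abs_add_le (a.re + σ * a.im - c.re) (-(a.re - c.re))
        have e : a.re + σ * a.im - c.re + -(a.re - c.re) = σ * a.im := by ring
        rw [e, hσabs, abs_neg] at h
        exact h
      rw [← hc'im]
      linarith

/-- ★★★ WALSH–JENSEN PINNING.  On a legal frame, a JENSEN-ISOLATED upper zero `a` of `f^{(j)}` with CLEAN FEET has a non-real zero of `f^{(j+1)}`
in its closed Jensen disc, or an NL event of level `j` strictly inside the base `|x − Re a| < Im a`.  [Walsh, Ann. of Math. 22 (1920) §4; Kim,
PAMS 124 (1996) Thm 1 (window form, tree `…JensenWindow.no_nonreal_zero_of_localA_localB`); Jensen 1913 (tree `RhW08.QuadW.jensen_host_levelj`).] -/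
theorem pinning_of_jensenIsolated {η : ℝ} {f : ℂ → ℂ} {x₀ s hmax R Hs : ℝ} {B : ℕ} (hE : EngineHyps5 2 η f x₀ s hmax R Hs B)
    {j : ℕ} {a : ℂ} (ha : iteratedDeriv j f a = 0) (hapos : 0 < a.im) (hJ : JensenIsolated f j a) (hF : CleanFeet f j a) :
    (∃ w : ℂ, iteratedDeriv (j + 1) f w = 0 ∧ w.im ≠ 0 ∧ NestedStep a w) ∨ (∃ x : ℝ, |x - a.re| < a.im ∧ NLEventOf f j x) := by
  classical
  have hf : RealEntireLt2 f := realEntireLt2_of_hyps hE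
  have hnz : iteratedDeriv j f ≠ 0 := ne_zero_of_jensenIsolated hapos hJ
  set G : ℂ → ℂ := iteratedDeriv j f with hGdef
  have hG : RealEntireLt2 G :=
    { diff := differentiable_iteratedDeriv_of_entire hf.diff j
      growth := by
        obtain ⟨ρ, C, hρ0, hρ, hgr⟩ := hf.growth
        obtain ⟨ρ', C', h1, h2, h3⟩ := exists_growth_iteratedDeriv hf.diff hρ0 hρ hgr j
        exact ⟨ρ', C', h1, h2, h3⟩
      real := im_iteratedDeriv_ofReal hf.diff hf.real j }
  have hGreal : ∀ z : ℂ, G (conj z) = conj (G z) := apply_conj_eq_conj hG.diff hG.real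
  have e1 : deriv G = iteratedDeriv (j + 1) f := by rw [hGdef, ← iteratedDeriv_succ]
  have hHs : 0 ≤ Hs := hE.2.2.2.2.2.2.2.1
  have hstrip : ∀ c : ℂ, G c = 0 → |c.im| ≤ Hs := fun c hc => abs_im_le_of_level hE hnz hc
  have haHs : a.im ≤ Hs := by have := hstrip a ha; rwa [abs_of_pos hapos] at this
  -- the square window of `a`'s disc is a Jensen window
  have hclL : ∀ c : ℂ, G c = 0 → c.im ≠ 0 → |c.im| ≤ |(a.re - a.im) - c.re| := by
    have h := feet_clear (f := f) (j := j) hGreal hapos hJ (σ := -1) (Or.inr rfl)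
    simpa [sub_eq_add_neg] using h
  have hclR : ∀ c : ℂ, G c = 0 → c.im ≠ 0 → |c.im| ≤ |(a.re + a.im) - c.re| := by
    have h := feet_clear (f := f) (j := j) hGreal hapos hJ (σ := 1) (Or.inl rfl)
    simpa using h
  have hW : Window G (a.re - a.im) (a.re + a.im) (Hs + 1) := by
    refine ⟨by linarith, by linarith, ?_, ?_, ?_, hF.1, hF.2.1, ?_, ?_⟩
    · exact fun x _ => jensenClear_top (by linarith) (by linarith) hstrip
    · exact fun y _ hy0 => jensenClear_vline hy0 hclL
    · exact fun y _ hy0 => jensenClear_vline hy0 hclR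
    · rw [e1]; exact hF.2.2.1
    · rw [e1]; exact hF.2.2.2
  have hamem : a ∈ Ioo (a.re - a.im) (a.re + a.im) ×ℂ Ioo (-(Hs + 1)) (Hs + 1) :=
    mem_reProdIm.2 ⟨⟨by linarith, by linarith⟩, ⟨by linarith, by linarith⟩⟩
  by_cases hB : LocalB G (a.re - a.im) (a.re + a.im)
  · by_cases hA : LocalA G (a.re - a.im) (a.re + a.im) (Hs + 1)
    · exact absurd (no_nonreal_zero_of_localA_localB hG hW hA hB a hamem ha) hapos.ne'
    · -- a non-real critical point in the window; make it upper
      unfold LocalA at hA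
      push Not at hA
      obtain ⟨ρ, hρ, hdρ, hρim⟩ := hA
      have hdreal : ∀ x : ℝ, (deriv G x).im = 0 := im_deriv_ofReal hG.diff hG.real
      obtain ⟨w, hw, hdw, hwpos⟩ : ∃ w ∈ Ioo (a.re - a.im) (a.re + a.im) ×ℂ Ioo (-(Hs + 1)) (Hs + 1), deriv G w = 0 ∧ 0 < w.im := by
        rcases lt_or_gt_of_ne hρim with hneg | hpos
        · refine ⟨conj ρ, ?_, ?_, ?_⟩
          · rw [mem_reProdIm] at hρ ⊢
            obtain ⟨h1, h2, h3⟩ := hρ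
            refine ⟨by simpa using h1, ?_, ?_⟩
            · simp only [Complex.conj_im]; linarith [h3]
            · simp only [Complex.conj_im]; linarith [h2]
          · rw [apply_conj_eq_conj hG.diff.deriv hdreal ρ, hdρ, map_zero]
          · simpa using hneg
        · exact ⟨ρ, hρ, hdρ, hpos⟩
      have hfw : iteratedDeriv (j + 1) f w = 0 := by rw [← e1]; exact hdw
      have hwre : w.re ∈ Ioo (a.re - a.im) (a.re + a.im) := (mem_reProdIm.mp hw).1
      have hwa : |w.re - a.re| < a.im := by rw [abs_lt]; constructor <;> linarith [hwre.1, hwre.2]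
      -- Jensen host at level `j`
      obtain ⟨c, hc, hcpos, hdisc⟩ := jensen_host_levelj hf j hnz ha hwpos hfw
      refine Or.inl ⟨w, hfw, hwpos.ne', ?_⟩
      show (w.re - a.re) ^ 2 + w.im ^ 2 ≤ a.im ^ 2
      by_cases hca : c = a
      · rw [hca] at hdisc; exact hdisc
      · have hwc : |w.re - c.re| ≤ c.im := abs_le_of_sq_le_sq (by nlinarith [sq_nonneg w.im]) hcpos.le
        rcases hJ c hc hcpos hca with hfar | hnest
        · -- far: impossible
          exfalso
          have := abs_sub_le a.re w.re c.re
          rw [abs_sub_comm a.re w.re] at this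
          linarith
        · -- nested: the point lies in `c`'s disc, inside `a`'s
          have hD : (w.re - c.re) ^ 2 = |w.re - c.re| ^ 2 := (sq_abs _).symm
          have h1 : |w.re - a.re| ≤ |w.re - c.re| + |c.re - a.re| := abs_sub_le _ _ _
          have h2 : |c.re - a.re| = |a.re - c.re| := abs_sub_comm _ _
          have h0 : 0 ≤ |w.re - c.re| := abs_nonneg _
          have h0' : 0 ≤ |a.re - c.re| := abs_nonneg _
          have h3 : (w.re - a.re) ^ 2 = |w.re - a.re| ^ 2 := (sq_abs _).symm
          have h4 : |w.re - a.re| ^ 2 ≤ (|w.re - c.re| + |a.re - c.re|) ^ 2 := by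
            rw [h2] at h1
            exact pow_le_pow_left₀ (abs_nonneg _) h1 2
          nlinarith [hdisc, h4, hwc, hnest, h0, h0', hcpos, sq_nonneg w.im]
  · obtain ⟨x, hx, hNL⟩ := nlEventOf_of_not_localB hf j hB
    refine Or.inr ⟨x, ?_, hNL⟩
    rw [abs_lt]; constructor <;> linarith [hx.1, hx.2]

/-- ★ `TopPinning` IN THE JENSEN-ISOLATED CASE (literal conclusion of the law; `NoTallerToucher` is implied, `noTallerToucher_of_jensenIsolated`). -/
theorem topPinning_case_jensenIsolated {η : ℝ} {f : ℂ → ℂ} {x₀ s hmax R Hs : ℝ} {B : ℕ} (hE : EngineHyps5 2 η f x₀ s hmax R Hs B)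
    {j : ℕ} {a : ℂ} (ha : iteratedDeriv j f a = 0) (hapos : 0 < a.im) (hJ : JensenIsolated f j a) (hF : CleanFeet f j a) :
    (∃ w : ℂ, iteratedDeriv (j + 1) f w = 0 ∧ w.im ≠ 0 ∧ NestedStep a w) ∨ (∃ x : ℝ, |x - a.re| ≤ a.im ∧ NLEventOf f j x) := by
  rcases pinning_of_jensenIsolated hE ha hapos hJ hF with h | ⟨x, hx, hNL⟩
  · exact Or.inl h
  · exact Or.inr ⟨x, hx.le, hNL⟩

/-! ## §2 WEAK-FIELD PINNING: the isolated simple pair with a small cofactor field (closed-disc port of `tilt_of_isolated_circle`) -/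

/-- `q(z) = (z − a)² + b² ≠ 0` on any circle `‖z − a‖ = r` with `r ≠ |b|`. -/
theorem pairQ_ne_zero_of_ne {a b r : ℝ} (hrb : r ≠ |b|) {z : ℂ} (hz : ‖z - a‖ = r) : pairQ a b z ≠ 0 := by
  intro h0
  have h1 : (z - a) ^ 2 = -((b : ℂ) ^ 2) := by unfold pairQ at h0; linear_combination h0
  have h2 : ‖z - a‖ ^ 2 = |b| ^ 2 := by
    have := congrArg norm h1
    rw [norm_pow, norm_neg, norm_pow, Complex.norm_real, Real.norm_eq_abs] at this
    exact this
  rw [hz] at h2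
  have hr0 : 0 ≤ r := hz ▸ norm_nonneg _
  exact hrb ((sq_eq_sq₀ hr0 (abs_nonneg b)).1 h2)

/-- CIRCLE CLAUSE from a cofactor-field bound at ANY radius `r ≠ |b|` (the tree's `hcirc_of_cofactor_bound` needs `|b| < r`). -/
theorem hcirc_of_cofactor_bound' {G : ℂ → ℂ} {a b r L : ℝ} (hrb : r ≠ |b|)
    (hL : ∀ z : ℂ, ‖z - a‖ = r → ‖deriv G z / G z - 2 * (z - a) / pairQ a b z‖ ≤ L)
    (hrL : (r ^ 2 + b ^ 2) * L < 2 * r) :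
    ∀ z : ℂ, ‖z - a‖ = r → ‖pairQ a b z * (deriv G z / G z) - 2 * (z - a)‖ < 2 * r := by
  intro z hz
  have hq := pairQ_ne_zero_of_ne hrb hz
  have key : pairQ a b z * (deriv G z / G z) - 2 * (z - a) = pairQ a b z * (deriv G z / G z - 2 * (z - a) / pairQ a b z) := by
    field_simp
  rw [key, norm_mul]
  have hLz := hL z hz
  have h0 : 0 ≤ L := (norm_nonneg _).trans hLz
  calc ‖pairQ a b z‖ * ‖deriv G z / G z - 2 * (z - a) / pairQ a b z‖ ≤ (r ^ 2 + b ^ 2) * L :=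
        mul_le_mul (norm_pairQ_le_of_circle hz) hLz (norm_nonneg _) (by positivity)
    _ < 2 * r := hrL

/-- ★★ WEAK-FIELD PINNING: `f` real, `G := f^{(j)}` holomorphic on `ball a ρ`, a SIMPLE zero `a + ib` (`0 < b < ρ`) with `a ± ib` the only zeros
of `G` in the ball, cofactor field `‖G′/G − 2(z − a)/q‖ ≤ L` on the punctured ball, and the exact smallness `b·L < 1` ⇒ an NL event `x` with
`|x − a| < b` (INSIDE the closed axis disc).  Rouché radius `r = b(1 + bL)/2 ∈ [b/2, b)`: `(r² + b²)L ≤ (r + b)·bL < 2r`. -/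
theorem nl_in_disc_of_weakField {f : ℂ → ℂ} {j : ℕ} {a b ρ L : ℝ}
    (hf : ∀ z : ℂ, f (conj z) = conj (f z))
    (hD : DifferentiableOn ℂ (iteratedDeriv j f) (ball (a : ℂ) ρ))
    (hb : 0 < b) (hbρ : b < ρ)
    (hz : iteratedDeriv j f (a + b * I) = 0) (hz' : deriv (iteratedDeriv j f) (a + b * I) ≠ 0)
    (honly : ∀ z ∈ ball (a : ℂ) ρ, iteratedDeriv j f z = 0 → z = a + b * I ∨ z = a - b * I)
    (hL : ∀ z ∈ ball (a : ℂ) ρ, iteratedDeriv j f z ≠ 0 →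
      ‖deriv (iteratedDeriv j f) z / iteratedDeriv j f z - 2 * (z - a) / pairQ a b z‖ ≤ L)
    (hweak : b * L < 1) :
    ∃ x : ℝ, |x - a| < b ∧ NLEventOf f j x := by
  have hGreal := Literature.NumberTheory.LFunctions.iteratedDeriv_conj_of_conj hf j
  have hbρ' : |b| < ρ := by rw [abs_of_pos hb]; exact hbρ
  obtain ⟨h, hh, hh0, hG⟩ := exists_pair_factor_real hGreal hb.ne' hbρ' hD hz hz' honly
  -- `0 ≤ L` (the centre `a` is in the punctured ball)
  have hL0 : 0 ≤ L := by
    have hamem : (a : ℂ) ∈ ball (a : ℂ) ρ := mem_ball_self (hb.trans hbρ)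
    have hGa : iteratedDeriv j f a ≠ 0 := by
      intro h0
      rcases honly a hamem h0 with h1 | h1
      · have := congrArg Complex.im h1; simp at this; exact hb.ne' this.symm
      · have := congrArg Complex.im h1; simp at this; exact hb.ne' (by linarith)
    exact (norm_nonneg _).trans (hL a hamem hGa)
  -- the inner radius
  set t : ℝ := b * L with ht
  have ht0 : 0 ≤ t := by positivity
  set r : ℝ := b * (1 + t) / 2 with hr
  have hr0 : 0 < r := by positivity
  have hrb : r < b := by rw [hr]; nlinarith
  have hrρ : r < ρ := hrb.trans hbρ
  have hrL : (r ^ 2 + b ^ 2) * L < 2 * r := by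
    have e1 : r * L ≤ t := by rw [ht]; exact mul_le_mul_of_nonneg_right hrb.le hL0
    have e2 : (r ^ 2 + b ^ 2) * L = r * (r * L) + b * t := by rw [ht]; ring
    have e3 : r * (r * L) ≤ r * t := mul_le_mul_of_nonneg_left e1 hr0.le
    have e4 : t * (r + b) < 2 * r := by rw [hr]; nlinarith
    nlinarith
  have hrb' : r ≠ |b| := by rw [abs_of_pos hb]; exact hrb.ne
  -- circle clause at radius `r`
  have hcirc : ∀ z : ℂ, ‖z - a‖ = r →
      ‖pairQ a b z * (deriv (iteratedDeriv j f) z / iteratedDeriv j f z) - 2 * (z - a)‖ < 2 * r := by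
    refine hcirc_of_cofactor_bound' hrb' ?_ hrL
    intro z hzr
    have hzball : z ∈ ball (a : ℂ) ρ := by rw [mem_ball, dist_eq_norm]; linarith
    refine hL z hzball ?_
    intro hG0
    rcases honly z hzball hG0 with h1 | h1
    · have : ‖z - (a : ℂ)‖ = b := by
        rw [h1, show (a : ℂ) + b * I - a = b * I by ring, norm_mul, Complex.norm_I, mul_one, Complex.norm_real,
          Real.norm_eq_abs, abs_of_pos hb]
      linarith
    · have : ‖z - (a : ℂ)‖ = b := by
        rw [h1, show (a : ℂ) - b * I - a = -(b * I) by ring, norm_neg, norm_mul, Complex.norm_I, mul_one, Complex.norm_real,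
          Real.norm_eq_abs, abs_of_pos hb]
      linarith
  have hq : ∀ z : ℂ, ‖z - a‖ = r → pairQ a b z ≠ 0 := fun z hzr => pairQ_ne_zero_of_ne hrb' hzr
  have hsmall := hsmall_of_logDeriv hrρ hh hh0 hG hq hcirc
  obtain ⟨x, hxa, h1, h2, h3⟩ :=
    tilt_of_isolated_circle hr0 hrρ hb hh hh0 hG hsmall hGreal (hreal_of_conjSym hb.ne' hrρ.le hG hGreal)
  refine ⟨x, hxa.trans hrb, ?_, h2, ?_⟩
  · rw [iteratedDeriv_succ, h1]; simp
  · have e : iteratedDeriv (j + 2) f = deriv (deriv (iteratedDeriv j f)) := by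
      rw [show j + 2 = (j + 1) + 1 from rfl, iteratedDeriv_succ, iteratedDeriv_succ]
    rw [e]; exact h3

/-- ★ `TopPinning` IN THE WEAK-FIELD CASE (literal conclusion of the law, for an upper zero `a : ℂ`): the isolated simple pair `{a, ā}` in
`ball (Re a) ρ` with cofactor field `≤ L` and `Im a · L < 1` has an NL event in the closed axis disc. -/
theorem topPinning_case_weakField {f : ℂ → ℂ} {j : ℕ} {a : ℂ} {ρ L : ℝ}
    (hf : ∀ z : ℂ, f (conj z) = conj (f z))
    (hD : DifferentiableOn ℂ (iteratedDeriv j f) (ball (a.re : ℂ) ρ))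
    (hapos : 0 < a.im) (haρ : a.im < ρ)
    (hz : iteratedDeriv j f a = 0) (hz' : iteratedDeriv (j + 1) f a ≠ 0)
    (honly : ∀ z ∈ ball (a.re : ℂ) ρ, iteratedDeriv j f z = 0 → z = a ∨ z = conj a)
    (hL : ∀ z ∈ ball (a.re : ℂ) ρ, iteratedDeriv j f z ≠ 0 →
      ‖deriv (iteratedDeriv j f) z / iteratedDeriv j f z - 2 * (z - a.re) / pairQ a.re a.im z‖ ≤ L)
    (hweak : a.im * L < 1) :
    (∃ w : ℂ, iteratedDeriv (j + 1) f w = 0 ∧ w.im ≠ 0 ∧ NestedStep a w) ∨ (∃ x : ℝ, |x - a.re| ≤ a.im ∧ NLEventOf f j x) := by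
  have ea : (a.re : ℂ) + a.im * I = a := Complex.re_add_im a
  have ea' : (a.re : ℂ) - a.im * I = conj a := by
    apply Complex.ext <;> simp
  have hz1 : iteratedDeriv j f (a.re + a.im * I) = 0 := by rw [ea]; exact hz
  have hz1' : deriv (iteratedDeriv j f) (a.re + a.im * I) ≠ 0 := by rw [ea, ← iteratedDeriv_succ]; exact hz'
  have honly' : ∀ z ∈ ball (a.re : ℂ) ρ, iteratedDeriv j f z = 0 → z = a.re + a.im * I ∨ z = a.re - a.im * I := by
    intro z hzb h0; rw [ea, ea']; exact honly z hzb h0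
  obtain ⟨x, hx, hNL⟩ := nl_in_disc_of_weakField hf hD hapos haρ hz1 hz1' honly' hL hweak
  exact Or.inr ⟨x, hx.le, hNL⟩

end

end RhW08.Lens1PinningIso
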